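import Literature.MathematicalPhysics.QuantumFieldTheory.Balaban1983to89.B9B8KnitTorusSocketBetaZero
import Literature.MathematicalPhysics.QuantumFieldTheory.Balaban1983to89.B9B8KnitAveragingClosenessAtCentre
import Literature.MathematicalPhysics.QuantumFieldTheory.Balaban1983to89.B9B8KnitCurvatureSmallness
import Literature.MathematicalPhysics.QuantumFieldTheory.Balaban1983to89.B8Thm2TorusLettersAllPerOfKnit

/-!
# `Balaban1983to89.B9B8KnitTorusSocketOfDeltaASide` — T. Bałaban, *Propagators and renormalization transformations for lattice gauge theories. I*, Commun.
# Math. Phys. **95** (1984) 17–40 [Balaban1985RegularSpaces], (1.58)–(1.60) pp. 86–87 and Prop. 3 p. 87 (the B-operators of Theorem 2 on the torus, p. 77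
# «Ω_j = T_η»); *Propagators for lattice gauge theories in a background field*, CMP **99** (1985) 389–434 [Balaban1985BackgroundPropagators], Thm 3.3 p. 399,
# (3.26) p. 395, (3.40)–(3.42) p. 397, (3.69) p. 404, Thm 3.11 p. 416; *Averaging operations for lattice gauge theories*, CMP **98** (1985) 17–51
# [Balaban1985Averaging], (52) p. 26: **THE TORUS SOCKET `SockB9P3Per` AT β = 0 FROM THE Δ_a-SIDE MEMBERS ALONE** — the (B)-line bond junction, file F6
# (the assembly of F4 `B9B8KnitAveragingClosenessAtCentre`, F5 `B9B8KnitCurvatureSmallness` and the knit-leg unitarity into file 8c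
# `B9B8KnitTorusSocketBetaZero`).

statement-level skeleton of published theorems with citation tags; proofs where landed; nothing here is a claim about the Yang–Mills mass gap

v1.1 (doc-only): the locator of the covariant averaging corrected to «(3.12)–(3.13) p.392, (3.14) p.393» (r06 g69 page check 20:02Z); no declaration changed.

THE TARGET.  File 8c's ★★★ `B9B8KnitTorusSocketBetaZero.sockB9P3Per_torusIdx_of_sectors₀` delivers pub-ymgap's guarded periodic socket
`SockB9P3Per P₀ L … 0 len η n ℤ^{d+1} torusLam torusLamb` (the `hS` input of the [B8] Thm 2 torus assembler at `m′ = n`) from ONE per-background binder `hY`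
with NINE conjuncts at `U = bgY i U₀` (`U₀` unitary, `N₀`-periodic, `InAk L n η α₀ ℤ^{d+1}`, `0 < α₀ ≤ a_T`): (1) `IsUnit Δ_a(U)`, (2)–(4) the three weighted
members of `G_a(U)` at `B₀`, (5) `IsUnit Δ′_a(U)`, (6) `IsUnit X(U)`, (7) the knit legs `parKnitY i U z w` unitary, (8) the curvature smallness
`|D*_U(𝒦_U − 1)D_U a + Δ′₂(U)a|₍₋₃₎ ≤ κ|a|₍₋₁₎` (Hermitian `a`), (9) the averaging closeness `|Q*(U)aQ(U)a − (c_fη)²(QQZdP(U₀)a♯)♭|₍₋₃₎ ≤ ε_Q|a|₍₋₁₎`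
(Hermitian `a`), under `2(κ + 14d·M·a_T + ε_Q)B₀ ≤ 1`.  Conjuncts (7), (8), (9) now have per-background suppliers in the tree —
`B8Thm2TorusLettersAllPerOfKnit.parKnitY_mem_of_inAk` ([B7] (52): the averaged fields stay in `U(N)` in the windows `C₀α₀ ≤ 1∕3`, `2α₀ ≤ c₂′`), F5
`B9B8KnitCurvatureSmallness.hcurv_bgY_of_inAk` (`κ(a_T) = (w₋₃∕w₋₁)·48(d+1)c_f²L^{−2n}·a_T`), F4 `B9B8KnitAveragingClosenessAtCentre.hQQ_parBY_of_inAk` (`ε_Q(a_T)`,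
at `parB = parBY i`, `0 < a_T ≤ α_Q∕L²`) — so THIS FILE reduces the socket to the Δ_a-SIDE members (1)–(6) alone (the G-B9-LETTERS road of record, p38 ∕ p33 ∕
p21 lineages, at `parS = parKnitY i`, `parB = parBY i`, `Gp = GpY i (parKnitY i)`) plus ONE numeric smallness condition on the threshold `a_T`.

WHAT THIS FILE PROVES (all `theorem`s; 0 `def`, 0 new named facts, 0 `sorry`; standard axioms; fibre `M_N(ℂ)` with Mathlib's `L²`-operator norm and
`letI : CStarAlgebra (Matrix (Fin N) (Fin N) ℂ) := {}` as in file 8c, `τ = tr`).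
* ★★★ `hY_parBY_of_deltaASide` — the nine-conjunct binder `hY` of file 8c (at `parB = parBY i`, `κ := κ(a_T)`, `ε_Q := ε_Q(a_T)`) FROM the six Δ_a-side
  conjuncts per background, for a member of constant level `n ≥ 1` with `k = n + 1` and the weights of record, a threshold `a_T` in the windows
  `0 < a_T ≤ α_Q∕L²`, `C₀(d+1)a_T ≤ 1∕3`, `2a_T ≤ c₂′(d+1, L)`.
* ★★★ `sockB9P3Per_torusIdx_of_deltaASide` — file 8c's conclusion `SockB9P3Per … 0 len η n ℤ^{d+1} torusLam torusLamb` (same explicit constants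
  `B = max 1 (4B₀·max 1 q_Q)`, `C = 2·max 0 (4B₀)·max 1 q_Q`, threshold `min (1∕16) (min a_T (min a_T (1∕(4B₀·14d·M + 1))))`) from the Δ_a-side members (1)–(6),
  the member-shape data (`hD`, `hkn`, `hlev`, `hw`, `hcf`, `hdvd`) and `2(κ(a_T) + 14d·M·a_T + ε_Q(a_T))B₀ ≤ 1`.

HONEST FRAMING.  Packaging only: file 8c's theorem applied to a binder assembled from three landed per-background suppliers; conjuncts (1)–(6) REMAIN DISPLAYED
(they are def-Y's Thm 3.3 ∕ Thm 3.11 ∕ Cor 3.6 data at the knit's letters, owed by the G-B9-LETTERS road); the numeric condition on `a_T` is displayed, not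
chosen (its solvability for small `a_T` at fixed `B₀`, `M` is plain from the formulas but is the assembler's business); nothing of NODE 00's, file 8c's or the
lane's files is modified; `stub_PV3A` NOT discharged; counts unmoved; one finite 𝕋⁴ programme at fixed ε, Bałaban AS PRINTED; the YM mass gap (Clay) is NOT
proved by any of this — nothing continuum ∕ ℝ⁴ ∕ OS.  Cell `lit-balaban`, seat t2s-1 g8 («B8 §3 Thm 2 TORUS SUPPLIER», (B)-line bond junction);
`--supports stmt-QuantumFields-19200`.

References: T. Bałaban, CMP 95 (1984) 17–40 [Balaban1985RegularSpaces] (1.7)–(1.8) p.77, (1.58)–(1.60) pp.86–87, Prop. 3 p.87; CMP 99 (1985) 389–434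
[Balaban1985BackgroundPropagators] (3.9)–(3.13) p.392, (3.14) p.393, (3.26) p.395, (3.40)–(3.42) p.397, Thm 3.3 p.399, (3.69) p.404, Thm 3.11 p.416; CMP 98 (1985)
17–51 [Balaban1985Averaging] (52) p.26.
-/

noncomputable section

namespace Literature.MathematicalPhysics.QuantumFieldTheory.Balaban1983to89.B9B8KnitTorusSocketOfDeltaASide

open scoped BigOperators
open Node00
open B7Prop1Explicit renaming Site → LSite
open B7Prop1Explicit (e)
open B7Prop2Explicit (unitaryUnits C0 c2' C0_pos avgClosed_unitaryUnits)
open B6KLevelCensusIndexV1 (KIdx)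
open B6GlobalChartV1 (PV)
open B8Ineq132 (InAk)
open B8LeafModelZd (ZdIdx)
open B8LeafModelZd3SockPer (SockB9P3Per)
open B8Thm4TorusAt (torusLam)
open B8Thm2TorusMember (TorusMember torusIdx torusLamb)
open B8ScaledSupNorm (weight)
open B9B8KnitBondTransfer (descBd liftBd)
open B9B8AveragingJunction (parKnitY)
open B8Thm2TorusLettersPerOfKnit (bgY)
open B8Thm2TorusLettersAllPerOfKnit (parKnitY_mem_of_inAk)
open B12Ineq417Flat (shiftCfg)
open B9SupplySockB9P3ZdLetters (OpsZd)
open B9Eq316AveragingTransposeZd (qQ betaTau wQ alphaQ)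
open B9Eq316AveragingTransposeZdPrinted (QQZdP)
open B9B8KnitTorusSocketBetaZero (sockB9P3Per_torusIdx_of_sectors₀)
open B9B8KnitAveragingClosenessAtCentre (hQQ_parBY_of_inAk)
open B9B8KnitCurvatureSmallness (hcurv_bgY_of_inAk)
open B9B8KnitLandauProjection (shiftCfg_eq_of_isPeriodic trace_faithful)
open T4TermwiseTorus (IsPeriodic)

variable {d ℓ : ℕ} {hd : 1 ≤ d + 1} {hL : Odd (ℓ + 1) ∧ 1 < ℓ + 1} {b₀ b₁ : ℝ}

section Matrix

open scoped Matrix Matrix.Norms.L2Operator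

variable {N : ℕ} [NeZero N] (i : KIdx d ℓ hd hL b₀ b₁) {n : ℕ}

/-- ★★★ **THE PER-BACKGROUND BINDER `hY` OF THE TORUS SOCKET FROM ITS Δ_a-SIDE MEMBERS** (`M_N(ℂ)`, `τ = tr`, `parB = parBY i`).  Given, for a threshold `a_T`
in the windows `0 < a_T ≤ α_Q∕L²`, `C₀(d+1)·a_T ≤ 1∕3`, `2a_T ≤ c₂′`, the Δ_a-SIDE members per admissible background (`IsUnit Δ_a`, the three weighted members
of `G_a` at `B₀`, `IsUnit Δ′_a`, `IsUnit X`), the FULL binder `hY` of `B9B8KnitTorusSocketBetaZero.sockB9P3Per_torusIdx_of_sectors₀` holds with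
`κ := κ(a_T)` (F5 `B9B8KnitCurvatureSmallness.hcurv_bgY_of_inAk`), `ε_Q := ε_Q(a_T)` (F4 `B9B8KnitAveragingClosenessAtCentre.hQQ_parBY_of_inAk`) and the knit legs
unitary (`B8Thm2TorusLettersAllPerOfKnit.parKnitY_mem_of_inAk`).
[cite: Balaban1985RegularSpaces, (1.58)–(1.60) pp.86–87, (1.7)–(1.8) p.77; Balaban1985BackgroundPropagators, (3.9)–(3.10) p.392, (3.12)–(3.13) p.392, (3.14) p.393, (3.41) p.397, (3.69) p.404; Balaban1985Averaging, (52) p.26] -/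
theorem hY_parBY_of_deltaASide (hL1 : 1 ≤ ℓ + 1)
    (τ : Matrix (Fin N) (Fin N) ℂ →ₗ[ℂ] ℂ) (hτ : ∀ a, τ a = Matrix.trace a) (hτt : ∀ a b, τ (a * b) = τ (b * a))
    {Cτ : ℝ} (hCτ : ∀ x y : Matrix (Fin N) (Fin N) ℂ, |(τ (star x * y)).re| ≤ Cτ * ‖x‖ * ‖y‖)
    (hD : ∀ x, i.D.lev x = n) (hkn : i.k = n + 1) (hlev : ∀ z : SiteY i, levY i z = n) (hn : 1 ≤ n)
    (hw : ∀ ι : IBondY i, i.w ι = i.cf ^ 2 * (((((ℓ + 1 : ℕ) : ℝ)) ^ (ι.1.1 : ℕ)) ^ (d + 1) * (1 / (((ℓ + 1 : ℕ) : ℝ)) ^ (ι.1.1 : ℕ)) ^ 2))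
    {η : ℝ} (hη : 0 < η) {k : ℕ} (hk : 1 ≤ k)
    {B₀ aT : ℝ} (haT : 0 < aT) (haTQ : aT ≤ alphaQ (d + 1) (ℓ + 1) / ((ℓ + 1 : ℕ) : ℝ) ^ 2)
    (haT3 : C0 (d + 1) * aT ≤ 1 / 3) (haT2 : 2 * aT ≤ c2' (d + 1) (ℓ + 1))
    (hΔ : letI : CStarAlgebra (Matrix (Fin N) (Fin N) ℂ) := {}
      ∀ (α₀ : ℝ) (U₀ : LSite (d + 1) → Fin (d + 1) → (Matrix (Fin N) (Fin N) ℂ)ˣ),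
      (∀ x κ, U₀ x κ ∈ B7Prop2Explicit.unitaryUnits (Matrix (Fin N) (Fin N) ℂ)) →
      IsPeriodic ((PV d ℓ i.m i.K hd hL).sitesPerDir 0) U₀ → 0 < α₀ → α₀ ≤ aT →
      InAk (ℓ + 1) n η α₀ (fun _ => (Set.univ : Set (LSite (d + 1)))) U₀ →
        IsUnit (deltaAY i (parKnitY i) (parBY i) (GpY i (parKnitY i)) (bgY i U₀)) ∧
        (∀ F, wNormBY i (-1) (GAY i (parKnitY i) (parBY i) (GpY i (parKnitY i)) (bgY i U₀) F) ≤ B₀ * wNormBY i (-3) F) ∧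
        (∀ F ν, wNormBY i (-2) (cdB i (bgY i U₀) ν (GAY i (parKnitY i) (parBY i) (GpY i (parKnitY i)) (bgY i U₀) F)) ≤ B₀ * wNormBY i (-3) F) ∧
        (∀ F, wNormBY i (-3) (lapB i (bgY i U₀) (GAY i (parKnitY i) (parBY i) (GpY i (parKnitY i)) (bgY i U₀) F)) ≤ B₀ * wNormBY i (-3) F) ∧
        IsUnit (deltaPrimeAY i (parKnitY i) (bgY i U₀)) ∧ IsUnit (XY i (parKnitY i) (GpY i (parKnitY i)) (bgY i U₀))) :
    letI : CStarAlgebra (Matrix (Fin N) (Fin N) ℂ) := {}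
      ∀ (α₀ : ℝ) (U₀ : LSite (d + 1) → Fin (d + 1) → (Matrix (Fin N) (Fin N) ℂ)ˣ),
      (∀ x κ, U₀ x κ ∈ B7Prop2Explicit.unitaryUnits (Matrix (Fin N) (Fin N) ℂ)) →
      IsPeriodic ((PV d ℓ i.m i.K hd hL).sitesPerDir 0) U₀ → 0 < α₀ → α₀ ≤ aT →
      InAk (ℓ + 1) n η α₀ (fun _ => (Set.univ : Set (LSite (d + 1)))) U₀ →
        IsUnit (deltaAY i (parKnitY i) (parBY i) (GpY i (parKnitY i)) (bgY i U₀)) ∧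
        (∀ F, wNormBY i (-1) (GAY i (parKnitY i) (parBY i) (GpY i (parKnitY i)) (bgY i U₀) F) ≤ B₀ * wNormBY i (-3) F) ∧
        (∀ F ν, wNormBY i (-2) (cdB i (bgY i U₀) ν (GAY i (parKnitY i) (parBY i) (GpY i (parKnitY i)) (bgY i U₀) F)) ≤ B₀ * wNormBY i (-3) F) ∧
        (∀ F, wNormBY i (-3) (lapB i (bgY i U₀) (GAY i (parKnitY i) (parBY i) (GpY i (parKnitY i)) (bgY i U₀) F)) ≤ B₀ * wNormBY i (-3) F) ∧
        IsUnit (deltaPrimeAY i (parKnitY i) (bgY i U₀)) ∧ IsUnit (XY i (parKnitY i) (GpY i (parKnitY i)) (bgY i U₀)) ∧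
        (∀ z w : SiteY i, parKnitY i (bgY i U₀) z w ∈ B7Prop2Explicit.unitaryUnits (Matrix (Fin N) (Fin N) ℂ)) ∧
        (∀ a : FBondY i → Matrix (Fin N) (Fin N) ℂ, (∀ b, IsSelfAdjoint (a b)) →
          wNormBY i (-3) (coCurlY i (bgY i U₀) (jordanY i (bgY i U₀) (curlY i (bgY i U₀) a) - curlY i (bgY i U₀) a) + curv2Y i (bgY i U₀) a) ≤
            (weight (ℓ + 1) |i.cf|⁻¹ (-3) n / weight (ℓ + 1) |i.cf|⁻¹ (-1) n *
              (48 * ((d : ℝ) + 1) * i.cf ^ 2 * (((((ℓ + 1 : ℕ) : ℝ)) ^ n)⁻¹) ^ 2 * aT)) * wNormBY i (-1) a) ∧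
        (∀ a : FBondY i → Matrix (Fin N) (Fin N) ℂ, (∀ b, IsSelfAdjoint (a b)) →
          wNormBY i (-3) (QsY i (parBY i) (bgY i U₀) (aY i (QY i (parBY i) (bgY i U₀) a)) - ((i.cf * η) ^ 2 : ℝ) •
              descBd i (QQZdP τ (ℓ + 1) (fun m => torusLamb (d := d + 1) m) (torusIdx (d := d + 1) hL1 ⟨η, hη, k, hk⟩) n U₀ (liftBd i a))) ≤
            (weight (ℓ + 1) |i.cf|⁻¹ (-3) n / weight (ℓ + 1) |i.cf|⁻¹ (-1) n *
              (8 * (4 * ((d : ℝ) + 2) ^ 2 * aT) * (i.cf ^ 2 * (((((ℓ + 1 : ℕ) : ℝ)) ^ n) ^ 2)⁻¹) +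
                (i.cf * η) ^ 2 * wQ (d := d + 1) (ℓ + 1) η n *
                  (2 * ((d : ℝ) + 1) * (Cτ * betaTau τ *
                    (6 * ((d : ℝ) + 1) * (13344 * ((d : ℝ) + 1) * ((d : ℝ) + 2) ^ 2 * ((d : ℝ) + 5) * (((ℓ + 1 : ℕ) : ℝ)) ^ (d + 4)) * η *
                      (((ℓ + 1 : ℕ) : ℝ)) ^ n * ((((ℓ + 1 : ℕ) : ℝ)) ^ n * (((((ℓ + 1 : ℕ) : ℝ)) ^ (d + 1)) ^ n)⁻¹) * aT))))) *
              wNormBY i (-1) a) := by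
  letI : CStarAlgebra (Matrix (Fin N) (Fin N) ℂ) := {}
  intro α₀ U₀ hU₀ hper hα₀ hα₀T hAk
  obtain ⟨h1, h2, h3, h4, h5, h6⟩ := hΔ α₀ U₀ hU₀ hper hα₀ hα₀T hAk
  have hτp : ∀ a : Matrix (Fin N) (Fin N) ℂ, a ≠ 0 → 0 < (τ (star a * a)).re := trace_faithful τ hτ
  have hU₀per : ∀ μ : Fin (d + 1), shiftCfg ((((PV d ℓ i.m i.K hd hL).sitesPerDir 0 : ℕ) : ℤ) • e μ) U₀ = U₀ :=
    fun μ => shiftCfg_eq_of_isPeriodic hper μ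
  have hα3 : C0 (d + 1) * α₀ ≤ 1 / 3 := (mul_le_mul_of_nonneg_left hα₀T (C0_pos (d + 1)).le).trans haT3
  have hα2 : 2 * α₀ ≤ c2' (d + 1) (ℓ + 1) := by linarith
  refine ⟨h1, h2, h3, h4, h5, h6, ?_, ?_, ?_⟩
  · exact parKnitY_mem_of_inAk i hlev hn (avgClosed_unitaryUnits (d + 1) (ℓ + 1)) hU₀ hU₀per hα₀ hα3 hα2 hAk
  · intro a _
    exact hcurv_bgY_of_inAk i hlev haT.le hα₀T hU₀ hper hAk a
  · intro a _
    exact hQQ_parBY_of_inAk τ i hτp hτt hCτ hD hkn hlev hw hL1 hη hk haT haTQ U₀ hU₀ hper hα₀T hAk a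

/-- ★★★ **[B8] (1.59) ON THE TORUS AT β = 0 FROM THE Δ_a-SIDE MEMBERS ALONE** (`M_N(ℂ)`, `τ = tr`, `parB = parBY i`): file 8c's
`sockB9P3Per_torusIdx_of_sectors₀` with the knit-leg unitarity, the curvature smallness `κ` and the averaging closeness `ε_Q` of its binder `hY` DISCHARGED per
background (F5, F4, `parKnitY_mem_of_inAk`) — the displayed inputs left are def-Y's Thm-3.3 ∕ 3.11 ∕ Cor-3.6 letter data per admissible background (`IsUnit Δ_a`,
the three weighted members of `G_a` at `B₀`, `IsUnit Δ′_a`, `IsUnit X`) and ONE numeric smallness condition on the threshold,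
`2(κ(a_T) + 14d·M·a_T + ε_Q(a_T))·B₀ ≤ 1`.
[cite: Balaban1985RegularSpaces, (1.58)–(1.60) pp.86–87, Prop. 3 p.87, p.77; Balaban1985BackgroundPropagators, Thm 3.3 p.399, (3.26) p.395, (3.40)–(3.42) p.397, (3.69) p.404, Thm 3.11 p.416] -/
theorem sockB9P3Per_torusIdx_of_deltaASide (hd2 : 2 ≤ d + 1) (hL1 : 1 ≤ ℓ + 1)
    (τ : Matrix (Fin N) (Fin N) ℂ →ₗ[ℂ] ℂ) (hτ : ∀ a, τ a = Matrix.trace a) (hτt : ∀ a b, τ (a * b) = τ (b * a))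
    {Cτ : ℝ} (hCτ : ∀ x y : Matrix (Fin N) (Fin N) ℂ, |(τ (star x * y)).re| ≤ Cτ * ‖x‖ * ‖y‖)
    (hD : ∀ x, i.D.lev x = n) (hkn : i.k = n + 1) (hlev : ∀ z : SiteY i, levY i z = n) (hn : 1 ≤ n)
    (hw : ∀ ι : IBondY i, i.w ι = i.cf ^ 2 * (((((ℓ + 1 : ℕ) : ℝ)) ^ (ι.1.1 : ℕ)) ^ (d + 1) * (1 / (((ℓ + 1 : ℕ) : ℝ)) ^ (ι.1.1 : ℕ)) ^ 2))
    (hcf : i.cf = (((ℓ + 1 : ℕ) : ℝ)) ^ (n + 1)) {η : ℝ} (hη : 0 < η) {k : ℕ} (hk : 1 ≤ k)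
    (hdvd : (ℓ + 1) ^ n ∣ (PV d ℓ i.m i.K hd hL).sitesPerDir 0)
    (ops₀ : ℝ → ZdIdx (d + 1) (ℓ + 1) → ℕ →
      (letI : CStarAlgebra (Matrix (Fin N) (Fin N) ℂ) := {}; OpsZd (d + 1) (Matrix (Fin N) (Fin N) ℂ)))
    {M : ℝ} (hM1 : 1 ≤ M) {B₀ aT : ℝ} (hB₀ : 0 < B₀) (haT : 0 < aT) (haTQ : aT ≤ alphaQ (d + 1) (ℓ + 1) / ((ℓ + 1 : ℕ) : ℝ) ^ 2)
    (haT3 : C0 (d + 1) * aT ≤ 1 / 3) (haT2 : 2 * aT ≤ c2' (d + 1) (ℓ + 1))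
    (hεB : 2 * ((weight (ℓ + 1) |i.cf|⁻¹ (-3) n / weight (ℓ + 1) |i.cf|⁻¹ (-1) n *
              (48 * ((d : ℝ) + 1) * i.cf ^ 2 * (((((ℓ + 1 : ℕ) : ℝ)) ^ n)⁻¹) ^ 2 * aT)) + 14 * d * M * aT +
            (weight (ℓ + 1) |i.cf|⁻¹ (-3) n / weight (ℓ + 1) |i.cf|⁻¹ (-1) n *
              (8 * (4 * ((d : ℝ) + 2) ^ 2 * aT) * (i.cf ^ 2 * (((((ℓ + 1 : ℕ) : ℝ)) ^ n) ^ 2)⁻¹) +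
                (i.cf * η) ^ 2 * wQ (d := d + 1) (ℓ + 1) η n *
                  (2 * ((d : ℝ) + 1) * (Cτ * (letI : CStarAlgebra (Matrix (Fin N) (Fin N) ℂ) := {}; betaTau τ) *
                    (6 * ((d : ℝ) + 1) * (13344 * ((d : ℝ) + 1) * ((d : ℝ) + 2) ^ 2 * ((d : ℝ) + 5) * (((ℓ + 1 : ℕ) : ℝ)) ^ (d + 4)) * η *
                      (((ℓ + 1 : ℕ) : ℝ)) ^ n * ((((ℓ + 1 : ℕ) : ℝ)) ^ n * (((((ℓ + 1 : ℕ) : ℝ)) ^ (d + 1)) ^ n)⁻¹) * aT)))))) * B₀ ≤ 1)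
    (hΔ : letI : CStarAlgebra (Matrix (Fin N) (Fin N) ℂ) := {}
      ∀ (α₀ : ℝ) (U₀ : LSite (d + 1) → Fin (d + 1) → (Matrix (Fin N) (Fin N) ℂ)ˣ),
      (∀ x κ, U₀ x κ ∈ B7Prop2Explicit.unitaryUnits (Matrix (Fin N) (Fin N) ℂ)) →
      IsPeriodic ((PV d ℓ i.m i.K hd hL).sitesPerDir 0) U₀ → 0 < α₀ → α₀ ≤ aT →
      InAk (ℓ + 1) n η α₀ (fun _ => (Set.univ : Set (LSite (d + 1)))) U₀ →
        IsUnit (deltaAY i (parKnitY i) (parBY i) (GpY i (parKnitY i)) (bgY i U₀)) ∧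
        (∀ F, wNormBY i (-1) (GAY i (parKnitY i) (parBY i) (GpY i (parKnitY i)) (bgY i U₀) F) ≤ B₀ * wNormBY i (-3) F) ∧
        (∀ F ν, wNormBY i (-2) (cdB i (bgY i U₀) ν (GAY i (parKnitY i) (parBY i) (GpY i (parKnitY i)) (bgY i U₀) F)) ≤ B₀ * wNormBY i (-3) F) ∧
        (∀ F, wNormBY i (-3) (lapB i (bgY i U₀) (GAY i (parKnitY i) (parBY i) (GpY i (parKnitY i)) (bgY i U₀) F)) ≤ B₀ * wNormBY i (-3) F) ∧
        IsUnit (deltaPrimeAY i (parKnitY i) (bgY i U₀)) ∧ IsUnit (XY i (parKnitY i) (GpY i (parKnitY i)) (bgY i U₀)))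
    (len : LSite (d + 1) → ℝ) :
    letI : CStarAlgebra (Matrix (Fin N) (Fin N) ℂ) := {}
    SockB9P3Per (𝔸 := Matrix (Fin N) (Fin N) ℂ) ((PV d ℓ i.m i.K hd hL).sitesPerDir 0) (ℓ + 1)
      (max 1 (2 * (2 * B₀) * max 1 (qQ (d + 1) (ℓ + 1) Cτ (betaTau τ) 0)))
      (2 * max 0 (2 * (2 * B₀)) * max 1 (qQ (d + 1) (ℓ + 1) Cτ (betaTau τ) 0))
      (min (1 / 16) (min aT (min aT (1 / (2 * (2 * B₀) * (14 * ((d + 1 - 1 : ℕ) : ℝ)) * M + 1)))))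
      0 len η n (fun _ => (Set.univ : Set (LSite (d + 1)))) (fun m => torusLam (d := d + 1) m) (fun m => torusLamb (d := d + 1) m) := by
  letI : CStarAlgebra (Matrix (Fin N) (Fin N) ℂ) := {}
  have hY := hY_parBY_of_deltaASide i hL1 τ hτ hτt hCτ hD hkn hlev hn hw hη hk (B₀ := B₀) haT haTQ haT3 haT2 hΔ
  have hw0 : 0 ≤ weight (ℓ + 1) |i.cf|⁻¹ (-3) n / weight (ℓ + 1) |i.cf|⁻¹ (-1) n :=
    div_nonneg (B9B8KnitNormsTransfer.weight_level_pos i (-3 : ℝ) n).le (B9B8KnitNormsTransfer.weight_level_pos i (-1 : ℝ) n).le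
  have hwQ : 0 ≤ wQ (d := d + 1) (ℓ + 1) η n := B9B8KnitAveragingClosenessOfColumns.wQ_nonneg' (d := d) (ℓ + 1) hη.le n
  have hβ : 0 ≤ Cτ * betaTau τ := by
    have h := hCτ 1 1
    simp only [norm_one, mul_one] at h
    have hC : 0 ≤ Cτ := (abs_nonneg _).trans h
    exact mul_nonneg hC (by unfold betaTau; split_ifs <;> [exact Finset.sum_nonneg fun _ _ => mul_nonneg (norm_nonneg _) (norm_nonneg _); exact le_rfl])
  have hκ : 0 ≤ weight (ℓ + 1) |i.cf|⁻¹ (-3) n / weight (ℓ + 1) |i.cf|⁻¹ (-1) n *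
      (48 * ((d : ℝ) + 1) * i.cf ^ 2 * (((((ℓ + 1 : ℕ) : ℝ)) ^ n)⁻¹) ^ 2 * aT) := by positivity
  have hεQ : 0 ≤ weight (ℓ + 1) |i.cf|⁻¹ (-3) n / weight (ℓ + 1) |i.cf|⁻¹ (-1) n *
      (8 * (4 * ((d : ℝ) + 2) ^ 2 * aT) * (i.cf ^ 2 * (((((ℓ + 1 : ℕ) : ℝ)) ^ n) ^ 2)⁻¹) +
        (i.cf * η) ^ 2 * wQ (d := d + 1) (ℓ + 1) η n *
          (2 * ((d : ℝ) + 1) * (Cτ * betaTau τ *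
            (6 * ((d : ℝ) + 1) * (13344 * ((d : ℝ) + 1) * ((d : ℝ) + 2) ^ 2 * ((d : ℝ) + 5) * (((ℓ + 1 : ℕ) : ℝ)) ^ (d + 4)) * η *
              (((ℓ + 1 : ℕ) : ℝ)) ^ n * ((((ℓ + 1 : ℕ) : ℝ)) ^ n * (((((ℓ + 1 : ℕ) : ℝ)) ^ (d + 1)) ^ n)⁻¹) * aT)))) := by
    have hη0 : 0 ≤ η := hη.le
    have h1 : 0 ≤ Cτ * betaTau τ *
        (6 * ((d : ℝ) + 1) * (13344 * ((d : ℝ) + 1) * ((d : ℝ) + 2) ^ 2 * ((d : ℝ) + 5) * (((ℓ + 1 : ℕ) : ℝ)) ^ (d + 4)) * η *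
          (((ℓ + 1 : ℕ) : ℝ)) ^ n * ((((ℓ + 1 : ℕ) : ℝ)) ^ n * (((((ℓ + 1 : ℕ) : ℝ)) ^ (d + 1)) ^ n)⁻¹) * aT) :=
      mul_nonneg hβ (by positivity)
    positivity
  exact sockB9P3Per_torusIdx_of_sectors₀ i hd2 hL1 τ hτ hτt hCτ hlev hcf hη hk hdvd ops₀ hM1 (parBY i) hB₀ hκ hεQ haT.le hεB hY len

end Matrix

end Literature.MathematicalPhysics.QuantumFieldTheory.Balaban1983to89.B9B8KnitTorusSocketOfDeltaASide
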